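import Literature.Topology.FourManifolds.LatticeFormsOrthogonalGroupHyperbolicSumThree
import HarnessLib

/-!
# `U^{⊕4}` (Markman's `V = H¹(X,ℤ) ⊕ H¹(X̂,ℤ)` of an abelian surface): `SO⁺(4U) = E(4U)` is perfect, `O⁺(4U) = ⟨σ_r : r² = −2⟩`,
# `[O(4U), O(4U)] = SO⁺(4U)`, and **`O(4U)` is generated by the reflections in `(±2)`-vectors** (Wall) — in the nested model,
# for every lattice isometric to it, and for the standard `hyperbolicSum 4`
# (Gritsenko–Hulek–Sankaran 2009 Thm. 1.1, Thm. 1.7, §3.3 (SO), §4; Markman 2023 §5.1 "O(V) is generated by the reflections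
# `−ρ(v)`, `(v,v)_V = ±2`, by [Wall]")

Trunk T-4MAN vocabulary. The inductive step `SO⁺(L₁ ⊕ U) ⊆ E_U(L₁)` of row g49-#7 applied to `L₁ = 3U` (whose `SO⁺ = E` is
g49-#7), then the `3U` arguments of rows g49-#6, #8, #9, #13 verbatim one plane up. Written for lane `lit-hodgefound` (Track 2
foundations; prover seat `lit-hodgefound-p18`, gen 49, row g49-#14). THEOREMS ONLY — no definition, no named fact, no instance,
no notation.

## Sources, verbatim

* GHS, *J. Algebra* 322 (2009) (held `paper:arxiv-0810.1614`): p. 3 Thm. 1.1 (Kneser: `O′(L) = ⟨σ_aσ_b : a² = b² = −2⟩`), p. 4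
  Thm. 1.7 (`S̃O⁺(L)^{ab}` trivial, `Õ⁺(L)^{ab} ≅ ℤ/2ℤ`; here `L = 4U`, `rank₂ = rank₃ = 8`), p. 8 (SO) `S̃O⁺(L) = E_U(L₁)` and
  "`Õ⁺(L) = ⟨S̃O⁺(L), σ_{e−f}⟩`", p. 7 "`SO⁺(L) = ⟨E_U(L₁), SO⁺(L₁)⟩`"-type remark after Prop. 3.3.
* E. Markman, *The monodromy of generalized Kummer varieties…*, JEMS 25 (2023) §5.1 (held `paper:arxiv-1805.11574` p. 14):
  "`V := H¹(X,ℤ) ⊕ H¹(X̂,ℤ)` […] Then `V` is an even unimodular lattice, the orthogonal direct sum of four copies of the hyperbolic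
  plane […] The lattice `V` is the orthogonal direct sum of four copies of the even unimodular rank `2` hyperbolic lattice `U`.
  Hence, `O(V)` is generated by the reflections `−ρ(v)`, given in (5.7), by elements `v ∈ V` with `(v,v)_V = ±2`, by [wall]."
  ([wall] = C. T. C. Wall, *On the orthogonal groups of unimodular quadratic forms*, Math. Ann. 147 (1962).)

## Contents (all proved; `4U = ((H ⊕ H) ⊕ H) ⊕ H`, outer plane last)

* §1 `SO⁺(4U) = E_U(3U)` (`exists_uGens_eq_of_isOrientationPreserving_of_det_eq_one_fourU`,
  `isOrientationPreserving_and_det_eq_one_iff_exists_uGens_fourU`).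
* §2 `O⁺(4U) = ⟨σ_r : r² = −2⟩` (`isWordIn_negTwoReflections_iff_isOrientationPreserving_fourU`), and **Wall's theorem for
  `4U`: every isometry is a word in reflections in `(±2)`-vectors** (`isWordIn_reflections_fourU`).
* §3 `SO⁺(4U)` is a word in commutators of admissible words; `[O(4U), O(4U)] = SO⁺(4U)` (`isWordIn_commutators_iff_fourU`).
* §4 every lattice isometric to `4U`, and `hyperbolicSum 4` (`hyperbolicSum_four_isWordIn_negTwoReflections_iff`,
  `hyperbolicSum_four_isWordIn_reflections`, `hyperbolicSum_four_isWordIn_commutators_iff`).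
-/

noncomputable section

open Module
open LinearMap (BilinForm)
open LinearMap.BilinForm
open LinearMap.BilinForm (IsometryEquiv)

namespace Literature.Topology.FourManifolds

/-! ### §1 `SO⁺(4U) = E_U(3U)` -/

section FourU

/-- `((H ⊕ H) ⊕ H) ⊕ H` is even. [cite: GritsenkoHulekSankaran2009, §1 ("integral even lattice")] -/
theorem isEven_fourU : ((((hyperbolicForm.prod hyperbolicForm).prod hyperbolicForm).prod hyperbolicForm)).IsEven :=
  isEven_prod_hyperbolic isEven_threeU

/-- `((H ⊕ H) ⊕ H) ⊕ H` is non-degenerate. [cite: GritsenkoHulekSankaran2009, §1] -/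
theorem nondegenerate_fourU : ((((hyperbolicForm.prod hyperbolicForm).prod hyperbolicForm).prod hyperbolicForm)).Nondegenerate :=
  nondegenerate_threeU.prod isUnimodular_hyperbolicForm_holds.nondegenerate

/-- **`SO⁺(U^{⊕4}) ⊆ E_U`**: every isometry of `((H ⊕ H) ⊕ H) ⊕ H` in `O⁺` with `det = 1` is an admissible word of Eichler
transvections for the outer hyperbolic pair — the inductive step of g49-#7 over `SO⁺(3U) = E(3U)`.
[cite: GritsenkoHulekSankaran2009, §3.3 (SO) and §3 (remark after Prop. 3.3)] -/
theorem exists_uGens_eq_of_isOrientationPreserving_of_det_eq_one_fourU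
    (φ : ((((hyperbolicForm.prod hyperbolicForm).prod hyperbolicForm).prod hyperbolicForm)).IsometryEquiv
      ((((hyperbolicForm.prod hyperbolicForm).prod hyperbolicForm).prod hyperbolicForm)))
    (h₁ : φ.IsOrientationPreserving)
    (h₂ : LinearMap.det (φ : (((Fin 2 → ℤ) × (Fin 2 → ℤ)) × (Fin 2 → ℤ)) × (Fin 2 → ℤ) →ₗ[ℤ]
      (((Fin 2 → ℤ) × (Fin 2 → ℤ)) × (Fin 2 → ℤ)) × (Fin 2 → ℤ)) = 1) :
    ∃ L : List (UGen ((((Fin 2 → ℤ) × (Fin 2 → ℤ)) × (Fin 2 → ℤ)) × (Fin 2 → ℤ))),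
      (∀ g ∈ L, g.IsAdmissible ((((hyperbolicForm.prod hyperbolicForm).prod hyperbolicForm).prod hyperbolicForm)) hypX hypY) ∧
      ∀ v, φ v = UGen.eval ((((hyperbolicForm.prod hyperbolicForm).prod hyperbolicForm).prod hyperbolicForm)) hypX hypY L v :=
  exists_uGens_eq_of_isOrientationPreserving_of_det_eq_one_prod
    ((isSymm_hyperbolicForm.prod isSymm_hyperbolicForm).prod isSymm_hyperbolicForm) isEven_threeU nondegenerate_threeU
    prod_prod_hyperbolic_hypX_hypX prod_prod_hyperbolic_hypY_hypY (prod_hyperbolic_hypX_hypY _)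
    (fun ψ hψ₁ hψ₂ ↦ exists_uGens_eq_of_isOrientationPreserving_of_det_eq_one_threeU ψ hψ₁ hψ₂) φ h₁ h₂

/-- **`SO⁺(U^{⊕4}) = E(4U)`**: `φ ∈ O⁺` with `det φ = 1` iff `φ` is an admissible word (words lie in `S̃O⁺`).
[cite: GritsenkoHulekSankaran2009, §3.3 (SO), §3.1 (8)] -/
theorem isOrientationPreserving_and_det_eq_one_iff_exists_uGens_fourU
    (φ : ((((hyperbolicForm.prod hyperbolicForm).prod hyperbolicForm).prod hyperbolicForm)).IsometryEquiv
      ((((hyperbolicForm.prod hyperbolicForm).prod hyperbolicForm).prod hyperbolicForm))) :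
    (φ.IsOrientationPreserving ∧ LinearMap.det (φ : (((Fin 2 → ℤ) × (Fin 2 → ℤ)) × (Fin 2 → ℤ)) × (Fin 2 → ℤ) →ₗ[ℤ]
        (((Fin 2 → ℤ) × (Fin 2 → ℤ)) × (Fin 2 → ℤ)) × (Fin 2 → ℤ)) = 1) ↔
      ∃ (L : List (UGen ((((Fin 2 → ℤ) × (Fin 2 → ℤ)) × (Fin 2 → ℤ)) × (Fin 2 → ℤ))))
        (hL : ∀ g ∈ L, g.IsAdmissible ((((hyperbolicForm.prod hyperbolicForm).prod hyperbolicForm).prod hyperbolicForm)) hypX hypY),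
        φ = UGen.evalEquiv (((isSymm_hyperbolicForm.prod isSymm_hyperbolicForm).prod isSymm_hyperbolicForm).prod isSymm_hyperbolicForm)
          prod_prod_hyperbolic_hypX_hypX prod_prod_hyperbolic_hypY_hypY L hL := by
  constructor
  · rintro ⟨h₁, h₂⟩
    obtain ⟨L, hL, hφ⟩ := exists_uGens_eq_of_isOrientationPreserving_of_det_eq_one_fourU φ h₁ h₂
    exact ⟨L, hL, DFunLike.ext _ _ fun v ↦ by rw [hφ, UGen.evalEquiv_apply]⟩
  · rintro ⟨L, hL, rfl⟩
    exact (UGen.evalEquiv_mem_stableSpecialOrthogonal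
      (((isSymm_hyperbolicForm.prod isSymm_hyperbolicForm).prod isSymm_hyperbolicForm).prod isSymm_hyperbolicForm) nondegenerate_fourU
      prod_prod_hyperbolic_hypX_hypX prod_prod_hyperbolic_hypY_hypY L hL).2

/-! ### §2 `O⁺(4U) = ⟨σ_r : r² = −2⟩` and Wall's generation of `O(4U)` by `(±2)`-reflections -/

/-- The vector `e₁ + εf₁` of the innermost plane of `((H ⊕ H) ⊕ H) ⊕ H` has norm `2ε` and is orthogonal to the two outer planes.
[cite: GritsenkoHulekSankaran2009, §3.3 Prop. 3.3 (iv) (σ_{e−f})] -/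
theorem fourU_inner_root (ε : ℤ) :
    (((((hyperbolicForm.prod hyperbolicForm).prod hyperbolicForm).prod hyperbolicForm))
        ((((![1, ε], 0), 0), 0) : (((Fin 2 → ℤ) × (Fin 2 → ℤ)) × (Fin 2 → ℤ)) × (Fin 2 → ℤ)) ((((![1, ε], 0), 0), 0)) = ε + ε) ∧
    (((((hyperbolicForm.prod hyperbolicForm).prod hyperbolicForm).prod hyperbolicForm)) hypX
        ((((![1, ε], 0), 0), 0) : (((Fin 2 → ℤ) × (Fin 2 → ℤ)) × (Fin 2 → ℤ)) × (Fin 2 → ℤ)) = 0) ∧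
    (((((hyperbolicForm.prod hyperbolicForm).prod hyperbolicForm).prod hyperbolicForm)) hypY
        ((((![1, ε], 0), 0), 0) : (((Fin 2 → ℤ) × (Fin 2 → ℤ)) × (Fin 2 → ℤ)) × (Fin 2 → ℤ)) = 0) ∧
    (((((hyperbolicForm.prod hyperbolicForm).prod hyperbolicForm).prod hyperbolicForm)) ((hypX, 0))
        ((((![1, ε], 0), 0), 0) : (((Fin 2 → ℤ) × (Fin 2 → ℤ)) × (Fin 2 → ℤ)) × (Fin 2 → ℤ)) = 0) ∧
    (((((hyperbolicForm.prod hyperbolicForm).prod hyperbolicForm).prod hyperbolicForm)) ((hypY, 0))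
        ((((![1, ε], 0), 0), 0) : (((Fin 2 → ℤ) × (Fin 2 → ℤ)) × (Fin 2 → ℤ)) × (Fin 2 → ℤ)) = 0) := by
  refine ⟨?_, ?_, ?_, ?_, ?_⟩
  · rw [prod_hyperbolic_inl_inl, prod_hyperbolic_inl_inl, prod_hyperbolic_inl_inl, hyperbolicForm_apply]
    simp
  · rw [prod_hyperbolic_hypX_inl]
  · rw [prod_hyperbolic_hypY_inl]
  · rw [prod_hyperbolic_inl_inl, prod_hyperbolic_hypX_inl]
  · rw [prod_hyperbolic_inl_inl, prod_hyperbolic_hypY_inl]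

/-- **`SO⁺(4U) ⊆ ⟨σ_r : r² = 2ε⟩`** for either sign. [cite: GritsenkoHulekSankaran2009, Thm. 1.1 and §3.3 (16)] -/
theorem isWordIn_reflections_of_isOrientationPreserving_of_det_eq_one_fourU {ε : ℤ} (hε : ε * ε = 1)
    (φ : ((((hyperbolicForm.prod hyperbolicForm).prod hyperbolicForm).prod hyperbolicForm)).IsometryEquiv
      ((((hyperbolicForm.prod hyperbolicForm).prod hyperbolicForm).prod hyperbolicForm)))
    (h₁ : φ.IsOrientationPreserving)
    (h₂ : LinearMap.det (φ : (((Fin 2 → ℤ) × (Fin 2 → ℤ)) × (Fin 2 → ℤ)) × (Fin 2 → ℤ) →ₗ[ℤ]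
      (((Fin 2 → ℤ) × (Fin 2 → ℤ)) × (Fin 2 → ℤ)) × (Fin 2 → ℤ)) = 1) :
    IsWordIn {ψ | ∃ (r : (((Fin 2 → ℤ) × (Fin 2 → ℤ)) × (Fin 2 → ℤ)) × (Fin 2 → ℤ))
        (hr : ((((hyperbolicForm.prod hyperbolicForm).prod hyperbolicForm).prod hyperbolicForm)) r r = ε + ε),
        ψ = normTwoReflectionEquiv
          ((((isSymm_hyperbolicForm.prod isSymm_hyperbolicForm).prod isSymm_hyperbolicForm).prod isSymm_hyperbolicForm)) r ε hr hε}
      φ := by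
  obtain ⟨L, hL, rfl⟩ := (isOrientationPreserving_and_det_eq_one_iff_exists_uGens_fourU φ).1 ⟨h₁, h₂⟩
  have P₁ := twoHyperbolicPairs_prod_prod_hyperbolic (Q := hyperbolicForm.prod hyperbolicForm)
    (isSymm_hyperbolicForm.prod isSymm_hyperbolicForm)
  obtain ⟨hrr, hxr, hyr, hx₁r, hy₁r⟩ := fourU_inner_root ε
  exact isWordIn_reflections_evalEquiv P₁ hε hxr hyr hx₁r hy₁r hrr L hL

/-- **`O⁺(U^{⊕4}) = ⟨σ_r : r² = −2⟩`**: an isometry of `((H ⊕ H) ⊕ H) ⊕ H` is a word in the `(−2)`-reflections iff it preserves the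
orientation of the positive `4`-space. [cite: GritsenkoHulekSankaran2009, Thm. 1.1 and §4 ("Õ⁺(L) = ⟨S̃O⁺(L), σ_{e−f}⟩")] -/
theorem isWordIn_negTwoReflections_iff_isOrientationPreserving_fourU
    (φ : ((((hyperbolicForm.prod hyperbolicForm).prod hyperbolicForm).prod hyperbolicForm)).IsometryEquiv
      ((((hyperbolicForm.prod hyperbolicForm).prod hyperbolicForm).prod hyperbolicForm))) :
    IsWordIn {ψ | ∃ (r : (((Fin 2 → ℤ) × (Fin 2 → ℤ)) × (Fin 2 → ℤ)) × (Fin 2 → ℤ))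
        (hr : ((((hyperbolicForm.prod hyperbolicForm).prod hyperbolicForm).prod hyperbolicForm)) r r = -1 + -1),
        ψ = normTwoReflectionEquiv
          ((((isSymm_hyperbolicForm.prod isSymm_hyperbolicForm).prod isSymm_hyperbolicForm).prod isSymm_hyperbolicForm)) r (-1) hr
          (by norm_num)} φ ↔
      φ.IsOrientationPreserving := by
  have hB : ((((hyperbolicForm.prod hyperbolicForm).prod hyperbolicForm).prod hyperbolicForm)).IsSymm :=
    (((isSymm_hyperbolicForm.prod isSymm_hyperbolicForm).prod isSymm_hyperbolicForm).prod isSymm_hyperbolicForm)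
  have hnd := nondegenerate_fourU
  refine ⟨fun hφ ↦ (IsWordIn.isOrientationPreserving_and_congr_eq_refl_of_negTwoReflections _ hB hnd
    (fun s hs ↦ hs) hφ).1, fun h₁ ↦ ?_⟩
  rcases LinearMap.BilinForm.IsometryEquiv.det_eq_one_or_eq_neg_one φ with hdet | hdet
  · exact isWordIn_reflections_of_isOrientationPreserving_of_det_eq_one_fourU (by norm_num) φ h₁ hdet
  · have P₁ := twoHyperbolicPairs_prod_prod_hyperbolic (Q := hyperbolicForm.prod hyperbolicForm)
      (isSymm_hyperbolicForm.prod isSymm_hyperbolicForm)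
    have hw := apply_add_smul_self hB P₁.xx P₁.yy P₁.xy (-1)
    set σ := normTwoReflectionEquiv hB (hypX + (-1 : ℤ) • hypY) (-1) hw (by norm_num) with hσ
    have hσO : σ.IsOrientationPreserving :=
      (isOrientationPreserving_normTwoReflectionEquiv_iff _ hB hnd _ (-1) hw (by norm_num)).2 rfl
    have hσdet := det_normTwoReflectionEquiv _ hB (hypX + (-1 : ℤ) • hypY) (-1) hw (by norm_num)
    have hφσ : IsWordIn {ψ | ∃ (r : (((Fin 2 → ℤ) × (Fin 2 → ℤ)) × (Fin 2 → ℤ)) × (Fin 2 → ℤ))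
        (hr : ((((hyperbolicForm.prod hyperbolicForm).prod hyperbolicForm).prod hyperbolicForm)) r r = -1 + -1),
        ψ = normTwoReflectionEquiv hB r (-1) hr (by norm_num)} (φ.trans σ) := by
      refine isWordIn_reflections_of_isOrientationPreserving_of_det_eq_one_fourU (by norm_num) _ ?_ ?_
      · rw [LinearMap.BilinForm.IsometryEquiv.isOrientationPreserving_trans_iff hB hnd]
        exact iff_of_true hσO h₁
      · rw [IsometryEquiv.det_trans_eq_mul, hσdet, hdet]
        norm_num
    refine (hφσ.trans (IsWordIn.of_mem ⟨hypX + (-1 : ℤ) • hypY, hw, rfl⟩)).congr fun v ↦ ?_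
    rw [LinearMap.BilinForm.IsometryEquiv.trans_apply, LinearMap.BilinForm.IsometryEquiv.trans_apply, ← hσ,
      normTwoReflectionEquiv_apply, normTwoReflectionEquiv_apply, ← LinearMap.BilinForm.normTwoReflection_apply,
      ← LinearMap.BilinForm.normTwoReflection_apply,
      normTwoReflection_add_smul_normTwoReflection_add_smul hB P₁.xx P₁.yy P₁.xy (by norm_num)]

/-- **Wall's theorem for `U^{⊕4}`: `O(4U)` is generated by the reflections in `(±2)`-vectors** — every isometry of
`((H ⊕ H) ⊕ H) ⊕ H` is a word in `{σ_r : r² = ±2}` (`O⁺ = ⟨(−2)-reflections⟩`, and `φ ∉ O⁺` becomes a `(−2)`-word after the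
`(+2)`-reflection `σ_{e+f} ∉ O⁺`). [cite: Markman2023GeneralizedKummers, §5.1 ("O(V) is generated by the reflections −ρ(v) … (v,v)_V = ±2, by [wall]")] [cite: Wall1962OrthogonalGroups] -/
theorem isWordIn_reflections_fourU
    (φ : ((((hyperbolicForm.prod hyperbolicForm).prod hyperbolicForm).prod hyperbolicForm)).IsometryEquiv
      ((((hyperbolicForm.prod hyperbolicForm).prod hyperbolicForm).prod hyperbolicForm))) :
    IsWordIn {ψ | ∃ (r : (((Fin 2 → ℤ) × (Fin 2 → ℤ)) × (Fin 2 → ℤ)) × (Fin 2 → ℤ)) (ε : ℤ) (hε : ε * ε = 1)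
        (hr : ((((hyperbolicForm.prod hyperbolicForm).prod hyperbolicForm).prod hyperbolicForm)) r r = ε + ε),
        ψ = normTwoReflectionEquiv
          ((((isSymm_hyperbolicForm.prod isSymm_hyperbolicForm).prod isSymm_hyperbolicForm).prod isSymm_hyperbolicForm)) r ε hr hε}
      φ := by
  have hB : ((((hyperbolicForm.prod hyperbolicForm).prod hyperbolicForm).prod hyperbolicForm)).IsSymm :=
    (((isSymm_hyperbolicForm.prod isSymm_hyperbolicForm).prod isSymm_hyperbolicForm).prod isSymm_hyperbolicForm)
  have hnd := nondegenerate_fourU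
  by_cases h₁ : φ.IsOrientationPreserving
  · refine ((isWordIn_negTwoReflections_iff_isOrientationPreserving_fourU φ).2 h₁).mono fun ψ hψ ↦ ?_
    obtain ⟨r, hr, h⟩ := hψ
    exact ⟨r, -1, by norm_num, hr, h⟩
  · -- `φ σ₊ ∈ O⁺` for the `(+2)`-reflection `σ₊ = σ_{x+y}` of the outer plane, and `φ = (φ σ₊) σ₊`
    have P₁ := twoHyperbolicPairs_prod_prod_hyperbolic (Q := hyperbolicForm.prod hyperbolicForm)
      (isSymm_hyperbolicForm.prod isSymm_hyperbolicForm)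
    have hw := apply_add_smul_self hB P₁.xx P₁.yy P₁.xy 1
    set σ := normTwoReflectionEquiv hB (hypX + (1 : ℤ) • hypY) 1 hw (by norm_num) with hσ
    have hσO : ¬ σ.IsOrientationPreserving := by
      rw [isOrientationPreserving_normTwoReflectionEquiv_iff _ hB hnd _ 1 hw (by norm_num)]
      norm_num
    have hφσ := (isWordIn_negTwoReflections_iff_isOrientationPreserving_fourU (φ.trans σ)).2
      ((LinearMap.BilinForm.IsometryEquiv.isOrientationPreserving_trans_iff hB hnd φ σ).2 (iff_of_false hσO h₁))
    have hφσ' : IsWordIn {ψ | ∃ (r : (((Fin 2 → ℤ) × (Fin 2 → ℤ)) × (Fin 2 → ℤ)) × (Fin 2 → ℤ)) (ε : ℤ) (hε : ε * ε = 1)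
        (hr : ((((hyperbolicForm.prod hyperbolicForm).prod hyperbolicForm).prod hyperbolicForm)) r r = ε + ε),
        ψ = normTwoReflectionEquiv hB r ε hr hε} (φ.trans σ) := by
      refine hφσ.mono fun ψ hψ ↦ ?_
      obtain ⟨r, hr, h⟩ := hψ
      exact ⟨r, -1, by norm_num, hr, h⟩
    have hσmem : σ ∈ {ψ | ∃ (r : (((Fin 2 → ℤ) × (Fin 2 → ℤ)) × (Fin 2 → ℤ)) × (Fin 2 → ℤ)) (ε : ℤ) (hε : ε * ε = 1)
        (hr : ((((hyperbolicForm.prod hyperbolicForm).prod hyperbolicForm).prod hyperbolicForm)) r r = ε + ε),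
        ψ = normTwoReflectionEquiv hB r ε hr hε} := ⟨hypX + (1 : ℤ) • hypY, 1, by norm_num, hw, rfl⟩
    refine (hφσ'.trans (IsWordIn.of_mem hσmem)).congr fun v ↦ ?_
    rw [LinearMap.BilinForm.IsometryEquiv.trans_apply, LinearMap.BilinForm.IsometryEquiv.trans_apply, hσ,
      normTwoReflectionEquiv_apply, normTwoReflectionEquiv_apply, ← LinearMap.BilinForm.normTwoReflection_apply,
      ← LinearMap.BilinForm.normTwoReflection_apply,
      normTwoReflection_add_smul_normTwoReflection_add_smul hB P₁.xx P₁.yy P₁.xy (by norm_num)]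

/-! ### §3 `SO⁺(4U)` is perfect; `[O(4U), O(4U)] = SO⁺(4U)` -/

/-- **`SO⁺(U^{⊕4})^{ab}` is trivial**: every `φ ∈ SO⁺(4U)` is a word in the commutators of admissible words (stated for any set
containing them) — `SO⁺(4U) = E(4U)` and `E` is perfect as soon as three hyperbolic planes are present (row g49-#6).
[cite: GritsenkoHulekSankaran2009, Thm. 1.7 and §4.1] -/
theorem isWordIn_commutators_of_isOrientationPreserving_of_det_eq_one_fourU
    {C : Set (((((hyperbolicForm.prod hyperbolicForm).prod hyperbolicForm).prod hyperbolicForm)).IsometryEquiv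
      ((((hyperbolicForm.prod hyperbolicForm).prod hyperbolicForm).prod hyperbolicForm)))}
    (hC : ∀ (l₁ l₂ : List (UGen ((((Fin 2 → ℤ) × (Fin 2 → ℤ)) × (Fin 2 → ℤ)) × (Fin 2 → ℤ))))
      (hl₁ : ∀ g ∈ l₁, g.IsAdmissible ((((hyperbolicForm.prod hyperbolicForm).prod hyperbolicForm).prod hyperbolicForm)) hypX hypY)
      (hl₂ : ∀ g ∈ l₂, g.IsAdmissible ((((hyperbolicForm.prod hyperbolicForm).prod hyperbolicForm).prod hyperbolicForm)) hypX hypY),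
      (((UGen.evalEquiv ((((isSymm_hyperbolicForm.prod isSymm_hyperbolicForm).prod isSymm_hyperbolicForm).prod isSymm_hyperbolicForm))
            prod_prod_hyperbolic_hypX_hypX prod_prod_hyperbolic_hypY_hypY l₂ hl₂).symm.trans
          (UGen.evalEquiv ((((isSymm_hyperbolicForm.prod isSymm_hyperbolicForm).prod isSymm_hyperbolicForm).prod isSymm_hyperbolicForm))
            prod_prod_hyperbolic_hypX_hypX prod_prod_hyperbolic_hypY_hypY l₁ hl₁).symm).trans
          (UGen.evalEquiv ((((isSymm_hyperbolicForm.prod isSymm_hyperbolicForm).prod isSymm_hyperbolicForm).prod isSymm_hyperbolicForm))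
            prod_prod_hyperbolic_hypX_hypX prod_prod_hyperbolic_hypY_hypY l₂ hl₂)).trans
        (UGen.evalEquiv ((((isSymm_hyperbolicForm.prod isSymm_hyperbolicForm).prod isSymm_hyperbolicForm).prod isSymm_hyperbolicForm))
            prod_prod_hyperbolic_hypX_hypX prod_prod_hyperbolic_hypY_hypY l₁ hl₁) ∈ C)
    (φ : ((((hyperbolicForm.prod hyperbolicForm).prod hyperbolicForm).prod hyperbolicForm)).IsometryEquiv
      ((((hyperbolicForm.prod hyperbolicForm).prod hyperbolicForm).prod hyperbolicForm)))
    (h₁ : φ.IsOrientationPreserving)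
    (h₂ : LinearMap.det (φ : (((Fin 2 → ℤ) × (Fin 2 → ℤ)) × (Fin 2 → ℤ)) × (Fin 2 → ℤ) →ₗ[ℤ]
      (((Fin 2 → ℤ) × (Fin 2 → ℤ)) × (Fin 2 → ℤ)) × (Fin 2 → ℤ)) = 1) :
    IsWordIn C φ := by
  obtain ⟨L, hL, rfl⟩ := (isOrientationPreserving_and_det_eq_one_iff_exists_uGens_fourU φ).1 ⟨h₁, h₂⟩
  have hH := isSymm_hyperbolicForm
  have hB3 : ((hyperbolicForm.prod hyperbolicForm).prod hyperbolicForm).IsSymm := (hH.prod hH).prod hH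
  -- outer pair with plane 3, outer pair with plane 2, plane 3 with plane 2
  have P₁ := twoHyperbolicPairs_prod_prod_hyperbolic (Q := hyperbolicForm.prod hyperbolicForm) (hH.prod hH)
  have P₃ := twoHyperbolicPairs_prod_prod_hyperbolic (Q := hyperbolicForm) hH
  have P₂ := twoHyperbolicPairs_prod_hyperbolic hB3 (x₁ := ((hypX, 0) : ((Fin 2 → ℤ) × (Fin 2 → ℤ)) × (Fin 2 → ℤ)))
    (y₁ := ((hypY, 0) : ((Fin 2 → ℤ) × (Fin 2 → ℤ)) × (Fin 2 → ℤ))) P₃.x₁x₁ P₃.y₁y₁ P₃.x₁y₁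
  have P₁₂ := P₃.inl hH
  exact isWordIn_commutators_evalEquiv P₁ P₂ P₁₂ isEven_fourU hC L hL

/-- **`[O(U^{⊕4}), O(U^{⊕4})] = SO⁺(U^{⊕4})`**: an isometry of `((H ⊕ H) ⊕ H) ⊕ H` is a word in commutators iff it lies in `O⁺` with
`det = 1` (so `SO⁺(4U)` is perfect and `O(4U)^{ab} ≅ (ℤ/2ℤ)²`). [cite: GritsenkoHulekSankaran2009, Thm. 1.7 and Cor. 1.8] -/
theorem isWordIn_commutators_iff_fourU
    (φ : ((((hyperbolicForm.prod hyperbolicForm).prod hyperbolicForm).prod hyperbolicForm)).IsometryEquiv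
      ((((hyperbolicForm.prod hyperbolicForm).prod hyperbolicForm).prod hyperbolicForm))) :
    IsWordIn {ψ | ∃ α β : ((((hyperbolicForm.prod hyperbolicForm).prod hyperbolicForm).prod hyperbolicForm)).IsometryEquiv
        ((((hyperbolicForm.prod hyperbolicForm).prod hyperbolicForm).prod hyperbolicForm)),
        ψ = ((β.symm.trans α.symm).trans β).trans α} φ ↔
      φ.IsOrientationPreserving ∧ LinearMap.det (φ : (((Fin 2 → ℤ) × (Fin 2 → ℤ)) × (Fin 2 → ℤ)) × (Fin 2 → ℤ) →ₗ[ℤ]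
        (((Fin 2 → ℤ) × (Fin 2 → ℤ)) × (Fin 2 → ℤ)) × (Fin 2 → ℤ)) = 1 := by
  have hB : ((((hyperbolicForm.prod hyperbolicForm).prod hyperbolicForm).prod hyperbolicForm)).IsSymm :=
    (((isSymm_hyperbolicForm.prod isSymm_hyperbolicForm).prod isSymm_hyperbolicForm).prod isSymm_hyperbolicForm)
  exact ⟨fun hφ ↦ IsWordIn.isOrientationPreserving_and_det_eq_one_of_commutators hB nondegenerate_fourU (fun s hs ↦ hs) hφ,
    fun h ↦ isWordIn_commutators_of_isOrientationPreserving_of_det_eq_one_fourU (fun l₁ l₂ hl₁ hl₂ ↦ by exact ⟨_, _, rfl⟩)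
      φ h.1 h.2⟩

end FourU

/-! ### §4 Every lattice isometric to `U^{⊕4}`; the standard model `hyperbolicSum 4` -/

section Isometric

variable {W W' : Type*} [AddCommGroup W] [AddCommGroup W'] {B : BilinForm ℤ W} {B' : BilinForm ℤ W'}

/-- **Words in `(±2)`-reflections transport along isometries** (`γσ_rγ⁻¹ = σ_{γ(r)}`, any sign).
[cite: GritsenkoHulekSankaran2009, §3.1 ("γσ_rγ⁻¹ = σ_{γ(r)}")] -/
theorem IsWordIn.reflections_conj (hB : B.IsSymm) (hB' : B'.IsSymm) {φ : B.IsometryEquiv B}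
    (hφ : IsWordIn {ψ : B.IsometryEquiv B | ∃ (r : W) (ε : ℤ) (hε : ε * ε = 1) (hr : B r r = ε + ε),
      ψ = normTwoReflectionEquiv hB r ε hr hε} φ) (e : B.IsometryEquiv B') :
    IsWordIn {ψ' : B'.IsometryEquiv B' | ∃ (r : W') (ε : ℤ) (hε : ε * ε = 1) (hr : B' r r = ε + ε),
      ψ' = normTwoReflectionEquiv hB' r ε hr hε} (e.symm.trans (φ.trans e)) := by
  refine (hφ.conj e).bind fun s hs ↦ ?_
  obtain ⟨ψ, ⟨r, ε, hε, hr, rfl⟩, rfl⟩ := hs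
  have hr' : B' (e r) (e r) = ε + ε := by rw [e.map_app, hr]
  exact IsWordIn.congr (IsWordIn.of_mem (φ := normTwoReflectionEquiv hB' (e r) ε hr' hε) ⟨e r, ε, hε, hr', rfl⟩)
    fun v ↦ (normTwoReflectionEquiv_conj_apply hB hB' e hr hε hr' v).symm

end Isometric

section Model

variable {W' : Type} [AddCommGroup W'] [Module.Finite ℤ W'] [Module.Free ℤ W'] {B' : BilinForm ℤ W'}

/-- **`O⁺(L) = ⟨σ_r : r² = −2⟩` for every lattice `L ≅ U^{⊕4}`.** [cite: GritsenkoHulekSankaran2009, Thm. 1.1 and §4] -/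
theorem isWordIn_negTwoReflections_iff_isOrientationPreserving_of_isometryEquiv_fourU (hB' : B'.IsSymm)
    (hnd' : B'.Nondegenerate)
    (e : ((((hyperbolicForm.prod hyperbolicForm).prod hyperbolicForm).prod hyperbolicForm)).IsometryEquiv B')
    (φ' : B'.IsometryEquiv B') :
    IsWordIn {ψ' : B'.IsometryEquiv B' | ∃ (r : W') (hr : B' r r = -1 + -1), ψ' = normTwoReflectionEquiv hB' r (-1) hr (by norm_num)}
      φ' ↔ φ'.IsOrientationPreserving := by
  have hB : ((((hyperbolicForm.prod hyperbolicForm).prod hyperbolicForm).prod hyperbolicForm)).IsSymm :=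
    (((isSymm_hyperbolicForm.prod isSymm_hyperbolicForm).prod isSymm_hyperbolicForm).prod isSymm_hyperbolicForm)
  refine ⟨fun h ↦ (IsWordIn.isOrientationPreserving_and_congr_eq_refl_of_negTwoReflections _ hB' hnd' (fun s hs ↦ hs) h).1,
    fun h₁ ↦ ?_⟩
  have hφ : (e.trans (φ'.trans e.symm)).IsOrientationPreserving :=
    (LinearMap.BilinForm.IsometryEquiv.isOrientationPreserving_trans_trans_symm_iff e φ').2 h₁
  have hw := (isWordIn_negTwoReflections_iff_isOrientationPreserving_fourU _).2 hφ
  exact (hw.negTwoReflections_conj hB hB' e).congr fun v ↦ IsometryEquiv.symm_trans_trans_trans_symm_trans_apply e φ' v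

omit [Module.Finite ℤ W'] [Module.Free ℤ W'] in
/-- **Wall's theorem for every lattice `L ≅ U^{⊕4}`: `O(L)` is generated by the reflections in `(±2)`-vectors.**
[cite: Markman2023GeneralizedKummers, §5.1 ("O(V) is generated by the reflections … (v,v)_V = ±2, by [wall]")] [cite: Wall1962OrthogonalGroups] -/
theorem isWordIn_reflections_of_isometryEquiv_fourU (hB' : B'.IsSymm)
    (e : ((((hyperbolicForm.prod hyperbolicForm).prod hyperbolicForm).prod hyperbolicForm)).IsometryEquiv B')
    (φ' : B'.IsometryEquiv B') :
    IsWordIn {ψ' : B'.IsometryEquiv B' | ∃ (r : W') (ε : ℤ) (hε : ε * ε = 1) (hr : B' r r = ε + ε),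
      ψ' = normTwoReflectionEquiv hB' r ε hr hε} φ' := by
  have hB : ((((hyperbolicForm.prod hyperbolicForm).prod hyperbolicForm).prod hyperbolicForm)).IsSymm :=
    (((isSymm_hyperbolicForm.prod isSymm_hyperbolicForm).prod isSymm_hyperbolicForm).prod isSymm_hyperbolicForm)
  exact ((isWordIn_reflections_fourU (e.trans (φ'.trans e.symm))).reflections_conj hB hB' e).congr fun v ↦
    IsometryEquiv.symm_trans_trans_trans_symm_trans_apply e φ' v

/-- **`[O(L), O(L)] = SO⁺(L)` for every lattice `L ≅ U^{⊕4}`.** [cite: GritsenkoHulekSankaran2009, Thm. 1.7 and Cor. 1.8] -/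
theorem isWordIn_commutators_iff_of_isometryEquiv_fourU (hB' : B'.IsSymm) (hnd' : B'.Nondegenerate)
    (e : ((((hyperbolicForm.prod hyperbolicForm).prod hyperbolicForm).prod hyperbolicForm)).IsometryEquiv B')
    (φ' : B'.IsometryEquiv B') :
    IsWordIn {ψ' : B'.IsometryEquiv B' | ∃ α β : B'.IsometryEquiv B', ψ' = ((β.symm.trans α.symm).trans β).trans α} φ' ↔
      φ'.IsOrientationPreserving ∧ LinearMap.det (φ' : W' →ₗ[ℤ] W') = 1 := by
  refine ⟨fun h ↦ IsWordIn.isOrientationPreserving_and_det_eq_one_of_commutators hB' hnd' (fun s hs ↦ hs) h, fun h ↦ ?_⟩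
  have hφ₁ : (e.trans (φ'.trans e.symm)).IsOrientationPreserving :=
    (LinearMap.BilinForm.IsometryEquiv.isOrientationPreserving_trans_trans_symm_iff e φ').2 h.1
  have hφ₂ : LinearMap.det ((e.trans (φ'.trans e.symm) :
      ((((hyperbolicForm.prod hyperbolicForm).prod hyperbolicForm).prod hyperbolicForm)).IsometryEquiv _) :
      (((Fin 2 → ℤ) × (Fin 2 → ℤ)) × (Fin 2 → ℤ)) × (Fin 2 → ℤ) →ₗ[ℤ] (((Fin 2 → ℤ) × (Fin 2 → ℤ)) × (Fin 2 → ℤ)) × (Fin 2 → ℤ)) = 1 := by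
    rw [IsometryEquiv.det_trans_trans_symm, h.2]
  have hw := (isWordIn_commutators_iff_fourU _).2 ⟨hφ₁, hφ₂⟩
  exact (hw.commutators_conj e).congr fun v ↦ IsometryEquiv.symm_trans_trans_trans_symm_trans_apply e φ' v

/-- **`((H ⊕ H) ⊕ H) ⊕ H ≅ U^{⊕4} = hyperbolicSum 4`** (even unimodular of rank `8`, signature `0`).
[cite: Huybrechts2016K3, Ch. 14 Cor. 1.3 (i)] [cite: Markman2023GeneralizedKummers, §5.1 ("the orthogonal direct sum of four copies of the hyperbolic plane")] -/
theorem nonempty_isometryEquiv_fourU_hyperbolicSum :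
    Nonempty (((((hyperbolicForm.prod hyperbolicForm).prod hyperbolicForm).prod hyperbolicForm)).IsometryEquiv (hyperbolicSum 4)) := by
  have hH := isSymm_hyperbolicForm
  have hs : ((((hyperbolicForm.prod hyperbolicForm).prod hyperbolicForm).prod hyperbolicForm)).IsSymm := ((hH.prod hH).prod hH).prod hH
  have hu : ((((hyperbolicForm.prod hyperbolicForm).prod hyperbolicForm).prod hyperbolicForm)).IsUnimodular :=
    isUnimodular_prod_iff.2 ⟨isUnimodular_prod_iff.2 ⟨isUnimodular_prod_iff.2
      ⟨isUnimodular_hyperbolicForm_holds, isUnimodular_hyperbolicForm_holds⟩, isUnimodular_hyperbolicForm_holds⟩,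
      isUnimodular_hyperbolicForm_holds⟩
  have h0 : hyperbolicForm.signature = 0 := signature_hyperbolicForm_holds
  have hsig : ((((hyperbolicForm.prod hyperbolicForm).prod hyperbolicForm).prod hyperbolicForm)).signature = 0 := by
    rw [signature_prod _ _ ((hH.prod hH).prod hH) hH, signature_prod _ _ (hH.prod hH) hH, signature_prod _ _ hH hH, h0, add_zero,
      add_zero, add_zero]
  have hrank : finrank ℤ ((((Fin 2 → ℤ) × (Fin 2 → ℤ)) × (Fin 2 → ℤ)) × (Fin 2 → ℤ)) = 2 * 4 := by simp
  exact equivalent_hyperbolicSum_of_signature_eq_zero _ hs hu isEven_fourU (by norm_num) hrank hsig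

/-- **`O⁺(U^{⊕4})` is generated by the `(−2)`-reflections** (standard model `hyperbolicSum 4`).
[cite: GritsenkoHulekSankaran2009, Thm. 1.1 and §4 for L = 4U] -/
theorem hyperbolicSum_four_isWordIn_negTwoReflections_iff (φ : (hyperbolicSum 4).IsometryEquiv (hyperbolicSum 4)) :
    IsWordIn {ψ : (hyperbolicSum 4).IsometryEquiv (hyperbolicSum 4) | ∃ (r : (Fin 4 → ℤ) × (Fin 4 → ℤ))
        (hr : hyperbolicSum 4 r r = -1 + -1), ψ = normTwoReflectionEquiv (isSymm_hyperbolicSum 4) r (-1) hr (by norm_num)} φ ↔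
      φ.IsOrientationPreserving := by
  obtain ⟨e⟩ := nonempty_isometryEquiv_fourU_hyperbolicSum
  exact isWordIn_negTwoReflections_iff_isOrientationPreserving_of_isometryEquiv_fourU (isSymm_hyperbolicSum 4)
    (isUnimodular_hyperbolicSum 4).nondegenerate e φ

/-- **Wall: `O(U^{⊕4})` is generated by the reflections in `(±2)`-vectors** (standard model `hyperbolicSum 4` — Markman's
`V = H¹(X,ℤ) ⊕ H¹(X̂,ℤ)`). [cite: Markman2023GeneralizedKummers, §5.1 ("O(V) is generated by the reflections −ρ(v) … (v,v)_V = ±2, by [wall]")] [cite: Wall1962OrthogonalGroups] -/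
theorem hyperbolicSum_four_isWordIn_reflections (φ : (hyperbolicSum 4).IsometryEquiv (hyperbolicSum 4)) :
    IsWordIn {ψ : (hyperbolicSum 4).IsometryEquiv (hyperbolicSum 4) | ∃ (r : (Fin 4 → ℤ) × (Fin 4 → ℤ)) (ε : ℤ) (hε : ε * ε = 1)
        (hr : hyperbolicSum 4 r r = ε + ε), ψ = normTwoReflectionEquiv (isSymm_hyperbolicSum 4) r ε hr hε} φ := by
  obtain ⟨e⟩ := nonempty_isometryEquiv_fourU_hyperbolicSum
  exact isWordIn_reflections_of_isometryEquiv_fourU (isSymm_hyperbolicSum 4) e φ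

/-- **`[O(U^{⊕4}), O(U^{⊕4})] = SO⁺(U^{⊕4})`** (standard model `hyperbolicSum 4`; `SO⁺(U^{⊕4})` is perfect).
[cite: GritsenkoHulekSankaran2009, Thm. 1.7 and Cor. 1.8 for L = 4U] -/
theorem hyperbolicSum_four_isWordIn_commutators_iff (φ : (hyperbolicSum 4).IsometryEquiv (hyperbolicSum 4)) :
    IsWordIn {ψ : (hyperbolicSum 4).IsometryEquiv (hyperbolicSum 4) |
        ∃ α β : (hyperbolicSum 4).IsometryEquiv (hyperbolicSum 4), ψ = ((β.symm.trans α.symm).trans β).trans α} φ ↔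
      φ.IsOrientationPreserving ∧ LinearMap.det (φ : (Fin 4 → ℤ) × (Fin 4 → ℤ) →ₗ[ℤ] (Fin 4 → ℤ) × (Fin 4 → ℤ)) = 1 := by
  obtain ⟨e⟩ := nonempty_isometryEquiv_fourU_hyperbolicSum
  exact isWordIn_commutators_iff_of_isometryEquiv_fourU (isSymm_hyperbolicSum 4) (isUnimodular_hyperbolicSum 4).nondegenerate e φ

end Model

end Literature.Topology.FourManifolds

end
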